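import Literature.NumberTheory.ModularSymbols.FullLevelHomologyTorusLevel
import HarnessLib

/-!
# Parabolic elements of `SL(2, ℤ)`: conjugates, powers and `δ`-conjugates

Topic `Literature/NumberTheory/ModularSymbols`; namespace `Literature.NumberTheory.ModularSymbols.FullLevel`; elementary
matrix algebra used by `FullLevelHomologySpreadKernel` (telescoping of the up/down dictionary along torus orbits).  Proved
theorems only; no named fact, no `sorry`, no instance, no notation.

* `isParabolic_conj_sl`: `s⁻¹xs` is parabolic iff `x` is (`x, s ∈ SL(2, ℤ)`);
* `exists_sign_nilpotent_of_isParabolic`, `isParabolic_pow`: a parabolic `x` is `ε(1 + N)` with `ε = ±1`, `N² = 0`, `N ≠ 0`,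
  hence `xⁿ = εⁿ(1 + nN)` is parabolic for every `n ≠ 0`;
* `conjDown_mem_range_scalar_iff`, `isParabolic_torusLevelEquiv_iff`: the `δ = diag(p, 1)`-conjugation dictionary
  `Γ_T → Γ₀(p²M)` preserves (non-)scalarity and parabolicity.

## References
* G. Shimura, *Introduction to the arithmetic theory of automorphic functions* (1971), §1.3 (parabolic/elliptic elements). [Shimura1971]
* F. Diamond, J. Shurman, *A First Course in Modular Forms* (2005), §1.5, §2.4 (conjugation by `diag(p,1)`). [DiamondShurman2005]
-/

noncomputable section

namespace Literature.NumberTheory.ModularSymbols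

namespace FullLevel

open scoped MatrixGroups
open CongruenceSubgroup Matrix


/-! ### Parabolic matrices: powers, conjugates, `δ`-conjugates -/

section Parabolic

/-- Trace is invariant under `SL(2, ℤ)`-conjugation: `tr(s⁻¹ x s) = tr x`. [cite: Shimura1971, §1.3] -/
theorem trace_conj_sl (s x : SL(2, ℤ)) :
    ((s⁻¹ * x * s : SL(2, ℤ)) : Matrix (Fin 2) (Fin 2) ℤ).trace = (x : Matrix (Fin 2) (Fin 2) ℤ).trace := by
  rw [Matrix.SpecialLinearGroup.coe_mul, Matrix.SpecialLinearGroup.coe_mul, Matrix.trace_mul_cycle,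
    ← Matrix.SpecialLinearGroup.coe_mul, mul_inv_cancel, Matrix.SpecialLinearGroup.coe_one, Matrix.one_mul]

/-- `scalar a = a • 1` (plumbing). [cite: Shimura1971, §1.3] -/
theorem scalar_eq_smul_one (a : ℤ) : Matrix.scalar (Fin 2) a = a • (1 : Matrix (Fin 2) (Fin 2) ℤ) := by
  rw [Matrix.smul_one_eq_diagonal]; rfl

/-- A scalar element of `SL(2, ℤ)` stays scalar under conjugation and conversely. [cite: Shimura1971, §1.3] -/
theorem coe_conj_mem_range_scalar_iff (s x : SL(2, ℤ)) :
    ((s⁻¹ * x * s : SL(2, ℤ)) : Matrix (Fin 2) (Fin 2) ℤ) ∈ Set.range (Matrix.scalar (Fin 2)) ↔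
      (x : Matrix (Fin 2) (Fin 2) ℤ) ∈ Set.range (Matrix.scalar (Fin 2)) := by
  constructor
  · rintro ⟨a, ha⟩
    refine ⟨a, ?_⟩
    have h : x = s * (s⁻¹ * x * s) * s⁻¹ := by group
    rw [h, Matrix.SpecialLinearGroup.coe_mul, Matrix.SpecialLinearGroup.coe_mul, ← ha, scalar_eq_smul_one, Matrix.mul_smul,
      Matrix.mul_one, Matrix.smul_mul, ← Matrix.SpecialLinearGroup.coe_mul, mul_inv_cancel, Matrix.SpecialLinearGroup.coe_one]
  · rintro ⟨a, ha⟩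
    refine ⟨a, ?_⟩
    rw [Matrix.SpecialLinearGroup.coe_mul, Matrix.SpecialLinearGroup.coe_mul, ← ha, scalar_eq_smul_one, Matrix.mul_smul,
      Matrix.mul_one, Matrix.smul_mul, ← Matrix.SpecialLinearGroup.coe_mul, inv_mul_cancel, Matrix.SpecialLinearGroup.coe_one]

/-- **Conjugates of parabolics are parabolic** (in `SL(2, ℤ)`). [cite: Shimura1971, §1.3] -/
theorem isParabolic_conj_sl (s x : SL(2, ℤ)) :
    ((s⁻¹ * x * s : SL(2, ℤ)) : Matrix (Fin 2) (Fin 2) ℤ).IsParabolic ↔ (x : Matrix (Fin 2) (Fin 2) ℤ).IsParabolic := by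
  rw [Matrix.IsParabolic, Matrix.IsParabolic, Matrix.discr_fin_two, Matrix.discr_fin_two, trace_conj_sl,
    Matrix.SpecialLinearGroup.det_coe, Matrix.SpecialLinearGroup.det_coe, coe_conj_mem_range_scalar_iff]

/-- Cayley–Hamilton for a parabolic `x ∈ SL(2, ℤ)`: with `ε = tr x / 2 ∈ {±1}`, `N := ε·x − 1` has `N² = 0` and trace `0`.
[cite: Shimura1971, §1.3] -/
theorem exists_sign_nilpotent_of_isParabolic {x : SL(2, ℤ)} (hx : (x : Matrix (Fin 2) (Fin 2) ℤ).IsParabolic) :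
    ∃ ε : ℤ, ε * ε = 1 ∧ ((ε • (x : Matrix (Fin 2) (Fin 2) ℤ) - 1) * (ε • (x : Matrix (Fin 2) (Fin 2) ℤ) - 1) = 0) ∧
      (ε • (x : Matrix (Fin 2) (Fin 2) ℤ) - 1).trace = 0 := by
  have hdisc := hx.2
  rw [Matrix.discr_fin_two, Matrix.SpecialLinearGroup.det_coe, mul_one, sub_eq_zero,
    show (4 : ℤ) = 2 ^ 2 by norm_num, sq_eq_sq_iff_eq_or_eq_neg] at hdisc
  have hdet : (x : Matrix (Fin 2) (Fin 2) ℤ) 0 0 * (x : Matrix (Fin 2) (Fin 2) ℤ) 1 1 -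
      (x : Matrix (Fin 2) (Fin 2) ℤ) 0 1 * (x : Matrix (Fin 2) (Fin 2) ℤ) 1 0 = 1 := by
    have := Matrix.det_fin_two (x : Matrix (Fin 2) (Fin 2) ℤ)
    rw [Matrix.SpecialLinearGroup.det_coe] at this
    exact this.symm
  have htr : (x : Matrix (Fin 2) (Fin 2) ℤ).trace = (x : Matrix (Fin 2) (Fin 2) ℤ) 0 0 + (x : Matrix (Fin 2) (Fin 2) ℤ) 1 1 :=
    Matrix.trace_fin_two _
  rcases hdisc with h | h
  · refine ⟨1, by norm_num, ?_, ?_⟩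
    · rw [htr] at h
      ext i j
      fin_cases i <;> fin_cases j
      · simp [Matrix.mul_apply, Fin.sum_univ_two, Matrix.one_apply]
        linear_combination (-1 : ℤ) * hdet + (x : Matrix (Fin 2) (Fin 2) ℤ) 0 0 * h
      · simp [Matrix.mul_apply, Fin.sum_univ_two, Matrix.one_apply]
        linear_combination (x : Matrix (Fin 2) (Fin 2) ℤ) 0 1 * h
      · simp [Matrix.mul_apply, Fin.sum_univ_two, Matrix.one_apply]
        linear_combination (x : Matrix (Fin 2) (Fin 2) ℤ) 1 0 * h
      · simp [Matrix.mul_apply, Fin.sum_univ_two, Matrix.one_apply]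
        linear_combination (-1 : ℤ) * hdet + (x : Matrix (Fin 2) (Fin 2) ℤ) 1 1 * h
    · rw [Matrix.trace_sub, Matrix.trace_smul, Matrix.trace_one, h]; simp
  · refine ⟨-1, by norm_num, ?_, ?_⟩
    · rw [htr] at h
      ext i j
      fin_cases i <;> fin_cases j
      · simp [Matrix.mul_apply, Fin.sum_univ_two, Matrix.one_apply]
        linear_combination (-1 : ℤ) * hdet + (x : Matrix (Fin 2) (Fin 2) ℤ) 0 0 * h
      · simp [Matrix.mul_apply, Fin.sum_univ_two, Matrix.one_apply]
        linear_combination (x : Matrix (Fin 2) (Fin 2) ℤ) 0 1 * h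
      · simp [Matrix.mul_apply, Fin.sum_univ_two, Matrix.one_apply]
        linear_combination (x : Matrix (Fin 2) (Fin 2) ℤ) 1 0 * h
      · simp [Matrix.mul_apply, Fin.sum_univ_two, Matrix.one_apply]
        linear_combination (-1 : ℤ) * hdet + (x : Matrix (Fin 2) (Fin 2) ℤ) 1 1 * h
    · rw [Matrix.trace_sub, Matrix.trace_smul, Matrix.trace_one, h]; simp

/-- `(1 + N)ⁿ = 1 + n·N` for `N² = 0`. [cite: Shimura1971, §1.3] -/
theorem one_add_pow_of_sq_zero {N : Matrix (Fin 2) (Fin 2) ℤ} (hN : N * N = 0) (n : ℕ) :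
    (1 + N) ^ n = 1 + (n : ℤ) • N := by
  induction n with
  | zero => simp
  | succ n ih =>
    rw [pow_succ, ih, add_mul, one_mul, mul_add, mul_one, smul_mul_assoc, hN, smul_zero, add_zero, Nat.cast_succ, add_smul,
      one_smul]
    abel

/-- **Powers of parabolics are parabolic**: `x ∈ SL(2, ℤ)` parabolic, `n ≥ 1` ⇒ `xⁿ` parabolic (`x = ε(1 + N)`, `N² = 0`,
`xⁿ = εⁿ(1 + nN)` has trace `2εⁿ` and is not scalar). [cite: Shimura1971, §1.3] -/
theorem isParabolic_pow {x : SL(2, ℤ)} (hx : (x : Matrix (Fin 2) (Fin 2) ℤ).IsParabolic) {n : ℕ} (hn : n ≠ 0) :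
    ((x ^ n : SL(2, ℤ)) : Matrix (Fin 2) (Fin 2) ℤ).IsParabolic := by
  obtain ⟨ε, hε, hN, htrN⟩ := exists_sign_nilpotent_of_isParabolic hx
  set A : Matrix (Fin 2) (Fin 2) ℤ := (x : Matrix (Fin 2) (Fin 2) ℤ) with hA
  set N : Matrix (Fin 2) (Fin 2) ℤ := ε • A - 1 with hNdef
  have hεA : ε • A = 1 + N := by rw [hNdef]; abel
  have hAε : A = ε • (1 + N) := by rw [← hεA, smul_smul, hε, one_smul]
  have hpow : A ^ n = ε ^ n • (1 + (n : ℤ) • N) := by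
    rw [hAε, smul_pow, one_add_pow_of_sq_zero hN]
  have hcoe : ((x ^ n : SL(2, ℤ)) : Matrix (Fin 2) (Fin 2) ℤ) = A ^ n := by rw [Matrix.SpecialLinearGroup.coe_pow]
  have hεn : ε ^ n * ε ^ n = 1 := by rw [← mul_pow, hε, one_pow]
  refine ⟨?_, ?_⟩
  · rintro ⟨a, ha⟩
    rw [hcoe, hpow, scalar_eq_smul_one] at ha
    -- `n • N` is scalar with trace `0`, hence `0`, hence `N = 0`: contradiction with `x` non-scalar
    have h1 : (n : ℤ) • N = (ε ^ n * a - 1) • (1 : Matrix (Fin 2) (Fin 2) ℤ) := by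
      have h0 : ε ^ n • (a • (1 : Matrix (Fin 2) (Fin 2) ℤ)) = 1 + (n : ℤ) • N := by
        rw [ha, smul_smul, hεn, one_smul]
      rw [sub_smul, one_smul, mul_smul, h0]
      abel
    have h2 : (ε ^ n * a - 1) = 0 := by
      have := congrArg Matrix.trace h1
      rw [Matrix.trace_smul, htrN, smul_zero, Matrix.trace_smul, Matrix.trace_one] at this
      simp only [smul_eq_mul, Fintype.card_fin, Nat.cast_ofNat] at this
      linarith
    rw [h2, zero_smul] at h1
    have hN0 : N = 0 := by
      rcases smul_eq_zero.1 h1 with h | h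
      · exact absurd (by exact_mod_cast h) hn
      · exact h
    apply hx.1
    refine ⟨ε, ?_⟩
    rw [scalar_eq_smul_one, hAε, hN0, add_zero]
  · rw [Matrix.discr_fin_two, Matrix.SpecialLinearGroup.det_coe, hcoe, hpow, Matrix.trace_smul, Matrix.trace_add,
      Matrix.trace_one, Matrix.trace_smul, htrN]
    simp only [smul_eq_mul, Fintype.card_fin, Nat.cast_ofNat]
    nlinarith [hεn]

variable (p M : ℕ) [Fact p.Prime] (hpM : Nat.Coprime p M)

/-- `δ⁻¹ A δ` is scalar iff `A` is (`p ∣ A₀₁`, `p ≠ 0`). [cite: DiamondShurman2005, §1.5] -/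
theorem conjDown_mem_range_scalar_iff {A : Matrix (Fin 2) (Fin 2) ℤ} (hA : (p : ℤ) ∣ A 0 1) :
    conjDown p A ∈ Set.range (Matrix.scalar (Fin 2)) ↔ A ∈ Set.range (Matrix.scalar (Fin 2)) := by
  have hp : (p : ℤ) ≠ 0 := by exact_mod_cast (Fact.out : p.Prime).ne_zero
  obtain ⟨b, hb⟩ := hA
  have hdiv : A 0 1 / p = b := by rw [hb, Int.mul_ediv_cancel_left _ hp]
  constructor
  · rintro ⟨a, ha⟩
    refine ⟨a, ?_⟩
    rw [scalar_eq_smul_one] at ha ⊢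
    have e := fun i j => congrFun (congrFun ha i) j
    have e00 := e 0 0; have e01 := e 0 1; have e10 := e 1 0; have e11 := e 1 1
    simp only [Matrix.smul_apply, Matrix.one_apply, conjDown, Matrix.of_apply, Matrix.cons_val', Matrix.cons_val_zero,
      Matrix.cons_val_one, Matrix.cons_val_fin_one, smul_eq_mul] at e00 e01 e10 e11
    simp only [Fin.isValue, ↓reduceIte, mul_one, Fin.zero_eq_one_iff, OfNat.ofNat_ne_one,
      mul_zero, one_ne_zero] at e00 e01 e10 e11
    have hb0 : b = 0 := by rw [← hdiv]; exact e01.symm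
    have h10 : A 1 0 = 0 := by
      rcases mul_eq_zero.1 e10.symm with h | h
      · exact h
      · exact absurd h hp
    ext i j
    fin_cases i <;> fin_cases j
    · simpa using e00
    · simp [hb, hb0]
    · simp [h10]
    · simpa using e11
  · rintro ⟨a, ha⟩
    refine ⟨a, ?_⟩
    rw [scalar_eq_smul_one] at ha ⊢
    rw [← ha]
    ext i j
    fin_cases i <;> fin_cases j <;> simp [conjDown]

/-- **`δ`-conjugation preserves parabolicity**: for `t ∈ Γ_T`, `δ⁻¹tδ ∈ Γ₀(p²M)` is parabolic iff `t` is.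
[cite: DiamondShurman2005, §1.5; Shimura1971, §1.3] -/
theorem isParabolic_torusLevelEquiv_iff (t : torusLevel p M) :
    (((torusLevelEquiv p M hpM t : Gamma0 (p ^ 2 * M)) : SL(2, ℤ)) : Matrix (Fin 2) (Fin 2) ℤ).IsParabolic ↔
      ((t.1 : SL(2, ℤ)) : Matrix (Fin 2) (Fin 2) ℤ).IsParabolic := by
  rw [coe_torusLevelEquiv, Matrix.IsParabolic, Matrix.IsParabolic, Matrix.discr_fin_two, Matrix.discr_fin_two,
    det_conjDown _ (dvd_entry01_of_mem_torusLevel p M t.2), conjDown_mem_range_scalar_iff p (dvd_entry01_of_mem_torusLevel p M t.2)]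
  simp [Matrix.trace_fin_two, conjDown]

end Parabolic

end FullLevel

end Literature.NumberTheory.ModularSymbols
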